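import Mathlib
import Summits.QuantumFields.BalabanUV.T4Continuum.Support.SliceTorusSkeleton
import Summits.QuantumFields.BalabanUV.T4Continuum.Support.SliceTorusFaces

/-!
# T⁴ programme, node NE3 (η-rate of the minimisers) — the slice-operator TORUS MODEL, supplement 2/2:
# NE3's typed skeleton with the consistency geometry INSTANTIATED on the unit-face skeleton

Eleventh generation of the NE3 prover lineage P1 of the cell `pub-balaban` (technique: implicit-function / fixed-point
structure of the one-step constrained variational problem, Bałaban CMP 102 (1985) = "B11", Sect. E, read as the DISCRETE
implicit-function theorem = STABILITY × CONSISTENCY).  File 4 of the tenth-generation series,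
`SliceTorusSkeleton.ne3Shape_torus_of_printedStatements`, states NE3's skeleton end to end on the torus with the face
sets `F k`, their radius `Nn k` and the five binders `hAf hℓ hFN hN hcard` free; `SliceTorusFaces` (this generation)
constructs the UNIT-FACE SKELETON `faceSkel d k N L` of the level-`k` torus `(ℤ/N·L^k)^d` and proves those binders
(`npl1_le`, `faces_hN` with `Nn k = d·(N·L^k)`, `ℓ = d·N`; `card_faceSkel_shell_le`, `faceConst_nonneg` with the
level-free codimension-one shell constant `faceConst d N = d·N·3·3^{d−2}`; `faces_hℓ`).  THIS FILE is the one-step composition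
[folklore]: **`ne3Shape_torusFaces_of_printedStatements`** = the skeleton with `F := fun k => faceSkel d k N L` and the
five geometry binders DISCHARGED — so that EVERY remaining hypothesis is an ANALYTIC reading, visible in one type:

* STABILITY: the literature seat's printed family statements `B9.Thm31Printed` (B9 Thm 3.1, (3.42)/(3.46)/(3.47)) and
  `B9.Stmt349Printed` (B9 (3.49)) HOLDING for the family of Bałaban's auxiliary propagators indexed by `(k, V, j)` over
  the torus block geometries (reading (I′)/(I″) of the records — the statements are printed for B9's objects; that the
  lineage's matrix carriers ARE those objects is the typing still owed, node U1a-sized), the identifications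
  `hA0 hA1 hF3 hK` (which matrix is which propagator / the operator model of the slices), `hbd` (B9's weighted distance
  dominates the block distance), `hτ ham`;
* CONSISTENCY: the located, UNPRINTED readings of `T4SliceTelescoping.ne3Shape_of_slices_rpow` — `hdl` (the reading
  `dl k V` is carried by the resolvent slices summed over the unit-face skeleton), `h1 h3 h4 h5` ((W2): the face
  transmission structure of `U_{k+1}(V)`, B11 (9)–(10) print global `C^{1,β}` only), `ht hosc hread hresp` (the
  oscillation/response bookkeeping of `T4EtaRateMin` / `T4FixedPointResponse`), `hpair : OneStepCorrectionRate`.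

## What is printed and located ([R] = certified wordings; NOTHING of it enters as a hypothesis discharged by citation)

* [R] B9 = Bałaban, *Propagators for lattice gauge theories in a background field*, CMP 99 (1985) 389–434: Thm 3.1 /
  (3.42), (3.46)–(3.47), (3.49), the class (3.35) — wordings reproduced byte-for-byte in the header of
  `T4SliceOperatorData` v1.1 (ll. 96–118; XREADs C-t4r3-50, C-ref5-206) and typed by the literature seat as the
  hypothesis SHAPES `B9.Thm31Printed`, `B9.Stmt349Printed`, `B9.Backgrounds.Reg335` (used BY NAME, as hypotheses).
* [R] B12 p. 251 (the periodic carrier) and B9 p. 397 (the nested blocks `Δ(y) = B^j(y)`) — as in files 1–4.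
* [model, located — records `t4/T4-EST-U1b-OSC.md` §4/§5]: the consistency layer lives on the unit faces (the
  DEFINITION of the two-grid comparison); `SliceTorusFaces` supplies only the counting on that skeleton.

Honest framing: finite-T⁴ ultraviolet bookkeeping about MINIMISERS (rung (B)+1 of the cell's ladder); no conditional of
the cell (`BetaPertH`, (B), (B^μ)) is used or hidden; nothing bears on infinite volume, a mass gap, or the Clay problem;
**NE3 is NOT proved** — the value is the typed skeleton with the gap located exactly: the hypotheses of
`ne3Shape_torusFaces_of_printedStatements` below, none of which is geometric any more.  ABSOLUTE RULE of the cell kept: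
no internally-minted statement enters as a cited fact; B9's theorems enter only as HYPOTHESES of the tree's typed,
cite-tagged shapes; the manuscripts under audit are not cited for any disputed step.  No `sorry`, no axioms beyond
Mathlib's.  PLACEMENT (human rule 2026-08-19): cell work under `Summits/QuantumFields/BalabanUV/`; imports file 4 of the
series (`Support.SliceTorusSkeleton`, p195531) and `Support.SliceTorusFaces`; moves nothing.  Records:
`t4/T4-EST-U1b-OSC.md` v1.23 (RESULT 30), `t4/T4-EST-NE3-P1.md` v2.21, GAPS G-ne3p1-37 of the cell `pub-balaban`.
-/

noncomputable section

open Finset Real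

namespace Summit.QuantumFields.BalabanUV.T4Continuum.SliceTorusFacesSkeleton

open Literature.MathematicalPhysics.QuantumFieldTheory.Balaban1983to89
open Literature.MathematicalPhysics.QuantumFieldTheory.Balaban1983to89.TreeLengthTorus (TPt)
open Literature.MathematicalPhysics.QuantumFieldTheory.Balaban1983to89.T4SliceTelescoping (sliceKernel)
open Literature.MathematicalPhysics.QuantumFieldTheory.Balaban1983to89.T4EtaRateMin (Readings NE3Shape)
open Literature.MathematicalPhysics.QuantumFieldTheory.Balaban1983to89.T4FixedPointResponse (OneStepCorrectionRate)
open Literature.MathematicalPhysics.QuantumFieldTheory.Balaban1983to89.T4SliceOperatorData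
open Summit.QuantumFields.BalabanUV.T4Continuum.SliceTorusBlocks (npl1)
open Summit.QuantumFields.BalabanUV.T4Continuum.SliceTorusBlockModel (matrixFamily fineKernelOf)
open Summit.QuantumFields.BalabanUV.T4Continuum.SliceTorusTower (levM cube nbd torusGeom)
open Summit.QuantumFields.BalabanUV.T4Continuum.SliceTorusSkeleton (ne3Shape_torus_of_printedStatements)
open Summit.QuantumFields.BalabanUV.T4Continuum.SliceTorusFaces
  (npl1_le faceSkel faceConst faceConst_nonneg card_faceSkel_shell_le faces_hN faces_hℓ)

variable (d N L : ℕ) [NeZero N] [NeZero L]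

/-- **NE3's typed skeleton on the torus, consistency geometry instantiated (unit-face skeleton).**  The theorem
`SliceTorusSkeleton.ne3Shape_torus_of_printedStatements` with `F := fun k => faceSkel d k N L`,
`Nn := fun k => d·(N·L^k)`, `Af := faceConst d N`, `ℓ := d·N`, its five geometry binders supplied by
`SliceTorusFaces`.  EVERY hypothesis left is analytic: STABILITY = `hT31`, `hT349` (the printed family statements for
THIS family — reading (I′)/(I″)), `hA0 hA1 hF3 hK hbd hτ ham`; CONSISTENCY = `hdl h1 h3 h4 h5 ht hosc hact hvol hread
hresp hpair` (located, unprinted) and sign conditions on constants.  CONCLUSION: printed thresholds `M₁, a₀ > 0` exist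
such that, once `M₁ ≤ M`, `Mα₀ ≤ a₀` and every background is in the class (3.35), `NE3Shape R C′ (L^{−a})` for some
`C′`.  HONEST: a SKELETON; NE3 is NOT proved. [folklore] -/
theorem ne3Shape_torusFaces_of_printedStatements {ι : Type} {Xr : Type*} [Fintype Xr] {R : Readings ι Xr}
    (M c35 : ℝ) (Bg : ℕ → ι → ℕ → B9.Backgrounds) (U : ∀ k V j, (Bg k V j).Cfg)
    (dist : ∀ k j : ℕ, TPt d (levM k N L j) → TPt d (levM k N L j) → ℝ)
    (A Fk : ∀ (k : ℕ) (V : ι) (j : ℕ), Fin 4 → (Bg k V j).Cfg →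
      Matrix (TPt d (N * L ^ k)) (TPt d (N * L ^ k)) ℝ)
    (G Ng K : ∀ k : ℕ, ι → ℕ → Matrix (TPt d (N * L ^ k)) (TPt d (N * L ^ k)) ℝ)
    (D : ∀ k : ℕ, ι → Matrix (TPt d (N * L ^ k)) (TPt d (N * L ^ k)) ℝ)
    (τ : ∀ k : ℕ, ι → ℕ → TPt d (N * L ^ k) → TPt d (N * L ^ k) → ℝ) (am : ℕ → ι → ℕ → ℝ)
    {z dl sig blk lam t osc nrm pair : ℕ → ι → ℝ} {CJ CB B CPo CD B0 CR Γ Λr ρ₂ a amax : ℝ}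
    (hL : 2 ≤ L) (ha0 : 0 < a) (ha : a < 1) (hd : 2 ≤ d) (hamax : 0 ≤ amax)
    (hbd : ∀ k j y y₁, (nbd d k N L j y y₁ : ℝ) ≤ dist k j y y₁)
    (hT31 : B9.Thm31Printed c35 (fun p : ℕ × ι × ℕ => torusGeom d p.1 N L M (dist p.1) p.2.2)
      (fun p : ℕ × ι × ℕ => Bg p.1 p.2.1 p.2.2)
      (fun p : ℕ × ι × ℕ =>
        matrixFamily (cube d p.1 N L p.2.2) (dist p.1 p.2.2) p.2.2 (L : ℝ) M (A p.1 p.2.1 p.2.2)))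
    (hT349 : B9.Stmt349Printed d c35 (fun p : ℕ × ι × ℕ => torusGeom d p.1 N L M (dist p.1) p.2.2)
      (fun p : ℕ × ι × ℕ => Bg p.1 p.2.1 p.2.2)
      (fun p : ℕ × ι × ℕ =>
        fineKernelOf (cube d p.1 N L p.2.2) (dist p.1 p.2.2) p.2.2 (L : ℝ) M (Fk p.1 p.2.1 p.2.2)))
    (hA0 : ∀ k V j, A k V j 0 (U k V j) = G k V j)
    (hA1 : ∀ k V j, A k V j 1 (U k V j) = (G k V j * D k V).transpose)
    (hF3 : ∀ k V j, Fk k V j 3 (U k V j) = Ng k V j)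
    (hτ : ∀ k V j z w, |τ k V j z w| ≤ 1) (ham : ∀ k V j, 0 ≤ am k V j ∧ am k V j ≤ amax)
    (hK : ∀ k V j, K k V j = massKernel (cube d k N L j) (τ k V j) (am k V j / ((L : ℝ) ^ j) ^ (d + 2)) + Ng k V j)
    (hdl : ∀ k, ∀ V ∈ R.dom, ∃ x : TPt d (N * L ^ k),
      dl k V ≤ ∑ y ∈ faceSkel d k N L, |∑ i ∈ Finset.range (k + 1), sliceKernel (G k V) (K k V) (D k V) i x y|)
    (h1 : ∀ k : ℕ, ∀ V ∈ R.dom, z k V ≤ dl k V * sig k V + blk k V)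
    (h3 : ∀ k : ℕ, ∀ V ∈ R.dom, 0 ≤ sig k V ∧ sig k V ≤ CJ * lam k V)
    (h4 : ∀ k : ℕ, ∀ V ∈ R.dom, 0 ≤ blk k V ∧ blk k V ≤ CB * (1 + k * Real.log L) * lam k V)
    (h5 : ∀ k : ℕ, ∀ V ∈ R.dom, 0 ≤ lam k V ∧ lam k V ≤ B * ((L : ℝ)⁻¹ ^ k) ^ 3)
    (hCJ : 0 ≤ CJ) (hCB : 0 ≤ CB) (hCPo : 0 ≤ CPo) (hCD : 0 ≤ CD) (hB : 0 ≤ B) (hB0 : 0 ≤ B0) (hCR : 0 ≤ CR)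
    (hΓ : 0 ≤ Γ) (hΛr : 0 ≤ Λr) (hρ₂ : 0 ≤ ρ₂)
    (ht : ∀ k : ℕ, ∀ V ∈ R.dom, t k V ≤ B0 * CR * (L : ℝ)⁻¹ ^ k)
    (hosc : ∀ k : ℕ, ∀ V ∈ R.dom, osc k V ≤ (1 + CD) * (1 + CPo) * z k V / ((L : ℝ)⁻¹ ^ k) ^ 2 + t k V)
    (hact : ∀ k : ℕ, ∀ V ∈ R.dom, R.act k V = ∑ x, R.loc k V x) (hvol : (Fintype.card Xr : ℝ) ≤ R.vol)
    (hread : ∀ k : ℕ, ∀ V ∈ R.dom, ∀ x : Xr,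
      |R.loc (k + 1) V x - R.loc k V x| ≤ Λr * nrm k V + pair k V)
    (hresp : ∀ k : ℕ, ∀ V ∈ R.dom, nrm k V ≤ Γ * osc k V)
    (hpair : OneStepCorrectionRate R.dom pair ρ₂ ((L : ℝ) ^ (-a))) :
    ∃ M₁ a₀ : ℝ, 0 < M₁ ∧ 0 < a₀ ∧
      (M₁ ≤ M → ∀ α₀ : ℝ, 0 < α₀ → M * α₀ ≤ a₀ →
        (∀ k V j, V ∈ R.dom → (Bg k V j).Reg335 c35 α₀ (U k V j)) →
          ∃ C' : ℝ, NE3Shape R C' ((L : ℝ) ^ (-a))) :=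
  ne3Shape_torus_of_printedStatements d N L M c35 Bg U dist A Fk G Ng K D τ am (fun k => faceSkel d k N L)
    (fun k => d * (N * L ^ k)) hL ha0 ha (faceConst_nonneg (d := d) (N := N)) (faces_hℓ d N hd) hd hamax hbd hT31
    hT349 hA0 hA1 hF3 hτ ham hK (fun _ x y _ => npl1_le (x - y)) (faces_hN d N L)
    (fun _ x r hr => card_faceSkel_shell_le hd x r hr) hdl h1 h3 h4 h5 hCJ hCB hCPo hCD hB hB0 hCR hΓ hΛr hρ₂ ht
    hosc hact hvol hread hresp hpair

end Summit.QuantumFields.BalabanUV.T4Continuum.SliceTorusFacesSkeleton
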